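import Mathlib.LinearAlgebra.Matrix.PosDef
import Mathlib.Analysis.RCLike.Basic
import HarnessLib

/-!
# Signed-involution blocks: a Hermitian matrix commuting with a signed involutive permutation is positive semidefinite as soon as
# its two FOLDED matrices `M i j ± ε j · M i (g j)` are — and those reduce to orbit representatives (half the size each)

Topic `Literature/Computation/Certificates` (family `hubbard`; seat hubbard-box-p3, S2 CERTIFIER-FAMILIES). Companion of `DominantSplitCertificate`.
Kernel floor certificates for cluster Hamiltonians (`HubbardOpenBoxCodedClusterCertificate`) certify `H_sector − q₀ ⪰ 0` by an `LDLᵀ`/Gram check of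
cost `n³/3`; a lattice reflection of the cluster acts on the occupation configurations of a sector as a permutation `g` (an involution) with a
fermionic sign `ε = ±1` (constant on `g`-orbits), and `H (g s) (g s') = ε s ε s' H s s'`. This file proves the textbook block-diagonalisation in a
DEVICE-READY form (no eigenvectors, no change of basis to build):

* §1 `foldPlus M g ε i j = M i j + ε j · M i (g j)`, `foldMinus M g ε i j = M i j − ε j · M i (g j)`; under the symmetry both are Hermitian
  (`isHermitian_foldPlus/Minus`).
* §2 **`posSemidef_of_signedInvolution`**: `M` Hermitian, `g` an involution, `ε i ∈ {1, −1}` with `ε (g i) = ε i`, `M (g i) (g j) = ε i ε j M i j`,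
  `foldPlus ⪰ 0` and `foldMinus ⪰ 0` ⇒ `M ⪰ 0`. Proof: `⟨v, Mv⟩ = ⟨v₊, Mv₊⟩ + ⟨v₋, Mv₋⟩` for `v± = (v ± Uv)/2`, `(Uv) i = ε i · v (g i)` (bilinearity +
  invariance `⟨Uv, M Uv⟩ = ⟨v, Mv⟩`), and `⟨v±, M v±⟩ = ½ · v±ᴴ (fold±) v±` (`v± = ½ Σ_i v±(i)·(e_i ± ε_i e_{g i})`).
* §3 REDUCTION TO REPRESENTATIVES: for a predicate `p` with `p i ∨ p (g i)` for all `i`, the folded matrices are positive semidefinite as soon as their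
  principal submatrices on `{i // p i}` are (`posSemidef_foldPlus_of_reps`, `…Minus…`: the rows of `g r` are `± ε r` times the rows of `r`), whence
  **`posSemidef_of_signedInvolution_reps`** — ONE reflection halves the certificate (two `LDLᵀ`s of half size = a quarter of the cost); apply twice for `Z₂ × Z₂`.
* §4 INTEGER form `posSemidef_intCast_of_signedInvolution_reps` (integer table `Z`, `ε : ι → ℤ`, all side conditions decidable; the two rep matrices are
  explicit integer tables `Z r r' ± ε r' · Z r (g r')`).

WHY: the one-band `2 × 4` cluster's binding sectors at `n = 7/8` (`(3,4)`: 3920, `(3,3)`: 3136, `(4,4)`: 4900) have no spectral slack for the dominant split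
(seat table DOMINANT-SPLIT-g18 §C); the box reflections `Z₂ × Z₂` cut them to blocks `≤ 1225`, i.e. `≈ 1/16` of the `LDLᵀ` cost. Everything is PROVED;
definitions with bodies: `foldPlus`, `foldMinus`; no number is asserted.

## Mathlib / tree search

REUSED: `Matrix.PosSemidef.of_dotProduct_mulVec_nonneg`, `Matrix.PosSemidef.dotProduct_mulVec_nonneg`, `Matrix.IsHermitian.ext/apply`, `Equiv.sum_comp`,
`Finset.sum_fiberwise_of_maps_to`, `Fintype.sum_prod_type`. Tree: `HubbardOpenBoxCodedClusterCertificateBlocks.groundEnergy_ge_of_kCertsG₃` uses the spin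
exchange only to skip mirrored sectors; `lean search 'foldPlus|signedInvolution|blockDiagonal.*PosSemidef'` (2026-08-28): nothing of this kind.

## References

* R. A. Horn, C. R. Johnson, *Matrix Analysis* (2nd ed., 2013), Observation 7.1.2 and §1.3 (simultaneous block diagonalisation by a commuting involution).
  [cite: HornJohnson2013, Observation 7.1.2]
* H. Q. Lin, J. E. Gubernatis, Comput. Phys. 7 (1993) 400, §III (symmetrised bases for exact diagonalisation of lattice clusters). [cite: LinGubernatis1993, §II]
-/

noncomputable section

open Finset Matrix
open scoped BigOperators ComplexOrder

namespace Literature.Computation.Certificates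

variable {𝕜 : Type*} [RCLike 𝕜]
variable {ι : Type*} [Fintype ι] [DecidableEq ι]

/-! ### §1 The folded matrices -/

/-- `foldPlus M g ε i j = M i j + ε j · M i (g j)` (twice the compression of `M` to the `U = +1` sector, written on all of `ι`). [cite: HornJohnson2013, Observation 7.1.2] -/
def foldPlus (M : Matrix ι ι 𝕜) (g : ι → ι) (ε : ι → 𝕜) : Matrix ι ι 𝕜 := fun i j => M i j + ε j * M i (g j)

/-- `foldMinus M g ε i j = M i j − ε j · M i (g j)`. [cite: HornJohnson2013, Observation 7.1.2] -/
def foldMinus (M : Matrix ι ι 𝕜) (g : ι → ι) (ε : ι → 𝕜) : Matrix ι ι 𝕜 := fun i j => M i j - ε j * M i (g j)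

section Symmetry

variable {M : Matrix ι ι 𝕜} {g : ι → ι} {ε : ι → 𝕜}

omit [Fintype ι] [DecidableEq ι] in
/-- `ε i` is real: `conj (ε i) = ε i`. [cite: HornJohnson2013, Observation 7.1.2] -/
theorem star_eps (hε : ∀ i, ε i = 1 ∨ ε i = -1) (i : ι) : star (ε i) = ε i := by
  rcases hε i with h | h <;> simp [h]

omit [Fintype ι] [DecidableEq ι] in
/-- `ε i ^ 2 = 1`. [cite: HornJohnson2013, Observation 7.1.2] -/
theorem eps_mul_self (hε : ∀ i, ε i = 1 ∨ ε i = -1) (i : ι) : ε i * ε i = 1 := by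
  rcases hε i with h | h <;> simp [h]

omit [Fintype ι] [DecidableEq ι] in
/-- The symmetry moved to one index: `M i (g j) = ε i ε j · M (g i) j`. [cite: HornJohnson2013, Observation 7.1.2] -/
theorem apply_g_right (hg : ∀ i, g (g i) = i) (hεg : ∀ i, ε (g i) = ε i) (hsym : ∀ i j, M (g i) (g j) = ε i * ε j * M i j)
    (i j : ι) : M i (g j) = ε i * ε j * M (g i) j := by
  have h := hsym (g i) j
  rw [hg, hεg] at h
  exact h

omit [Fintype ι] [DecidableEq ι] in
/-- Under the symmetry the folded matrices are Hermitian. [cite: HornJohnson2013, Observation 7.1.2] -/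
theorem isHermitian_foldPlus (hM : M.IsHermitian) (hg : ∀ i, g (g i) = i) (hε : ∀ i, ε i = 1 ∨ ε i = -1) (hεg : ∀ i, ε (g i) = ε i)
    (hsym : ∀ i j, M (g i) (g j) = ε i * ε j * M i j) : (foldPlus M g ε).IsHermitian := by
  refine Matrix.IsHermitian.ext fun i j => ?_
  simp only [foldPlus, star_add, star_mul', star_eps hε, hM.apply]
  rw [apply_g_right hg hεg hsym i j, show ε j * (ε i * ε j * M (g i) j) = ε i * (ε j * ε j) * M (g i) j by ring, eps_mul_self hε j,
    mul_one]

omit [Fintype ι] [DecidableEq ι] in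
/-- Under the symmetry the folded matrices are Hermitian. [cite: HornJohnson2013, Observation 7.1.2] -/
theorem isHermitian_foldMinus (hM : M.IsHermitian) (hg : ∀ i, g (g i) = i) (hε : ∀ i, ε i = 1 ∨ ε i = -1) (hεg : ∀ i, ε (g i) = ε i)
    (hsym : ∀ i j, M (g i) (g j) = ε i * ε j * M i j) : (foldMinus M g ε).IsHermitian := by
  refine Matrix.IsHermitian.ext fun i j => ?_
  simp only [foldMinus, star_sub, star_mul', star_eps hε, hM.apply]
  rw [apply_g_right hg hεg hsym i j, show ε j * (ε i * ε j * M (g i) j) = ε i * (ε j * ε j) * M (g i) j by ring, eps_mul_self hε j,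
    mul_one]

/-! ### §2 The block criterion -/

omit [Fintype ι] [DecidableEq ι] in
/-- `0 ≤ 2x ⇒ 0 ≤ x` in the star order of `𝕜`. [cite: HornJohnson2013, Observation 7.1.2] -/
theorem nonneg_of_two_mul_nonneg {x : 𝕜} (h : 0 ≤ (2 : 𝕜) * x) : 0 ≤ x := by
  have two : (2 : 𝕜) = ((2 : ℝ) : 𝕜) := by rw [RCLike.ofReal_ofNat]
  rw [two, RCLike.nonneg_iff, RCLike.re_ofReal_mul, RCLike.im_ofReal_mul] at h
  rw [RCLike.nonneg_iff]
  constructor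
  · linarith [h.1]
  · have := h.2; simpa using this

/-- The signed permutation action `(U v) i = ε i · v (g i)`. [cite: HornJohnson2013, Observation 7.1.2] -/
def sgnAct (g : ι → ι) (ε : ι → 𝕜) (v : ι → 𝕜) : ι → 𝕜 := fun i => ε i * v (g i)

omit [DecidableEq ι] in
/-- **Invariance of the form**: `⟨Uv, M Uv⟩ = ⟨v, M v⟩`. [cite: HornJohnson2013, Observation 7.1.2] -/
theorem form_sgnAct (hg : ∀ i, g (g i) = i) (hε : ∀ i, ε i = 1 ∨ ε i = -1) (hεg : ∀ i, ε (g i) = ε i) (hsym : ∀ i j, M (g i)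
    (g j) = ε i * ε j * M i j) (v : ι → 𝕜) : star (sgnAct g ε v) ⬝ᵥ (M *ᵥ sgnAct g ε v) = star v ⬝ᵥ (M *ᵥ v) := by
  have hgbij : Function.Bijective g := Function.Involutive.bijective hg
  set e : ι ≃ ι := Equiv.ofBijective g hgbij with he
  simp only [dotProduct, mulVec, Pi.star_apply, sgnAct, Finset.mul_sum]
  -- reindex both sums by `g`
  rw [← e.sum_comp]
  refine Finset.sum_congr rfl fun i _ => ?_
  rw [← e.sum_comp]
  refine Finset.sum_congr rfl fun j _ => ?_
  simp only [he, Equiv.ofBijective_apply, hg, star_mul', star_eps hε]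
  rw [hsym i j, hεg, hεg]
  have := eps_mul_self hε i; have := eps_mul_self hε j
  calc ε i * star (v i) * (ε i * ε j * M i j * (ε j * v j))
      = (ε i * ε i) * (ε j * ε j) * (star (v i) * (M i j * v j)) := by ring
    _ = star (v i) * (M i j * v j) := by rw [eps_mul_self hε i, eps_mul_self hε j, one_mul, one_mul]

omit [DecidableEq ι] in
/-- **Parallelogram split**: for ANY matrix `M` and any map `U`, with `v± = (v ± Uv)/2`:
`⟨v₊, Mv₊⟩ + ⟨v₋, Mv₋⟩ = ½(⟨v, Mv⟩ + ⟨Uv, M Uv⟩)`. [cite: HornJohnson2013, Observation 7.1.2] -/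
theorem form_split (M : Matrix ι ι 𝕜) (v w : ι → 𝕜) :
    star ((1/2 : 𝕜) • (v + w)) ⬝ᵥ (M *ᵥ ((1/2 : 𝕜) • (v + w))) + star ((1/2 : 𝕜) • (v - w)) ⬝ᵥ (M *ᵥ ((1/2 : 𝕜) • (v - w))) =
      (1/2 : 𝕜) * (star v ⬝ᵥ (M *ᵥ v) + star w ⬝ᵥ (M *ᵥ w)) := by
  simp only [star_smul, Matrix.mulVec_smul, dotProduct_smul, smul_dotProduct, smul_eq_mul, mulVec_add, mulVec_sub, dotProduct_add,
    dotProduct_sub, star_add, star_sub, add_dotProduct, sub_dotProduct]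
  have h2 : (star (1/2 : 𝕜)) = 1/2 := by simp
  rw [h2]
  ring

omit [DecidableEq ι] in
/-- **The folded form**: for `v₊ = ½(v + Uv)` one has `⟨v₊, M v₊⟩ = ½ · v₊ᴴ (foldPlus M g ε) v₊`; here stated for any `u` with `U u = u`:
`uᴴ (foldPlus) u = 2 ⟨u, Mu⟩`. [cite: HornJohnson2013, Observation 7.1.2] -/
theorem form_foldPlus_of_fixed (hg : ∀ i, g (g i) = i) (hεg : ∀ i, ε (g i) = ε i) {u : ι → 𝕜} (hu : ∀ i, ε i * u (g i) = u i) :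
    star u ⬝ᵥ (foldPlus M g ε *ᵥ u) = 2 * (star u ⬝ᵥ (M *ᵥ u)) := by
  have hgbij : Function.Bijective g := Function.Involutive.bijective hg
  have key : ∀ i, (foldPlus M g ε *ᵥ u) i = 2 * (M *ᵥ u) i := by
    intro i
    simp only [mulVec, dotProduct, foldPlus, add_mul, Finset.sum_add_distrib, two_mul]
    congr 1
    rw [← (Equiv.ofBijective g hgbij).sum_comp (fun j => ε j * M i (g j) * u j)]
    refine Finset.sum_congr rfl fun k _ => ?_
    simp only [Equiv.ofBijective_apply, hg, hεg]
    rw [show ε k * M i k * u (g k) = M i k * (ε k * u (g k)) by ring, hu k]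
  simp only [dotProduct, Pi.star_apply, key, Finset.mul_sum]
  exact Finset.sum_congr rfl fun i _ => by ring

omit [DecidableEq ι] in
/-- The `−` twin: `U u = −u` ⇒ `uᴴ (foldMinus) u = 2 ⟨u, Mu⟩`. [cite: HornJohnson2013, Observation 7.1.2] -/
theorem form_foldMinus_of_antifixed (hg : ∀ i, g (g i) = i) (hεg : ∀ i, ε (g i) = ε i) {u : ι → 𝕜} (hu : ∀ i, ε i * u (g i) = - u i) :
    star u ⬝ᵥ (foldMinus M g ε *ᵥ u) = 2 * (star u ⬝ᵥ (M *ᵥ u)) := by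
  have hgbij : Function.Bijective g := Function.Involutive.bijective hg
  have key : ∀ i, (foldMinus M g ε *ᵥ u) i = 2 * (M *ᵥ u) i := by
    intro i
    simp only [mulVec, dotProduct, foldMinus, sub_mul, Finset.sum_sub_distrib, two_mul]
    rw [← (Equiv.ofBijective g hgbij).sum_comp (fun j => ε j * M i (g j) * u j)]
    have h : ∑ k, (fun j => ε j * M i (g j) * u j) ((Equiv.ofBijective g hgbij) k) = ∑ k, -(M i k * u k) :=
      Finset.sum_congr rfl fun k _ => by
        simp only [Equiv.ofBijective_apply, hg, hεg]
        rw [show ε k * M i k * u (g k) = M i k * (ε k * u (g k)) by ring, hu k]; ring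
    rw [h, Finset.sum_neg_distrib]; ring
  simp only [dotProduct, Pi.star_apply, key, Finset.mul_sum]
  exact Finset.sum_congr rfl fun i _ => by ring

omit [DecidableEq ι] in
/-- **THE SIGNED-INVOLUTION BLOCK CRITERION.** `M` Hermitian with `M (g i) (g j) = ε i ε j M i j` for an involution `g` and signs `ε = ±1` constant on
`g`-orbits: if the folded matrices `M i j + ε j M i (g j)` and `M i j − ε j M i (g j)` are positive semidefinite, so is `M`.
[cite: HornJohnson2013, Observation 7.1.2] [cite: LinGubernatis1993, §II] -/
theorem posSemidef_of_signedInvolution (hM : M.IsHermitian) (hg : ∀ i, g (g i) = i) (hε : ∀ i, ε i = 1 ∨ ε i = -1) (hεg : ∀ i, ε (g i) = ε i)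
    (hsym : ∀ i j, M (g i) (g j) = ε i * ε j * M i j) (hP : (foldPlus M g ε).PosSemidef)
    (hN : (foldMinus M g ε).PosSemidef) : M.PosSemidef := by
  refine PosSemidef.of_dotProduct_mulVec_nonneg hM fun v => ?_
  set w := sgnAct g ε v with hw
  -- v = v₊ + v₋
  have hv : v = (1/2 : 𝕜) • (v + w) + (1/2 : 𝕜) • (v - w) := by
    funext i; simp only [Pi.add_apply, Pi.smul_apply, Pi.sub_apply, smul_eq_mul]; ring
  have hsplit := form_split M v w
  rw [form_sgnAct hg hε hεg hsym v, ← two_mul, ← mul_assoc, show (1/2 : 𝕜) * 2 = 1 by norm_num, one_mul] at hsplit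
  rw [← hsplit]
  -- the `+` part is `U`-fixed, the `−` part anti-fixed
  have hfix : ∀ i, ε i * ((1/2 : 𝕜) • (v + w)) (g i) = ((1/2 : 𝕜) • (v + w)) i := by
    intro i
    simp only [Pi.smul_apply, Pi.add_apply, smul_eq_mul, hw, sgnAct, hg, hεg]
    have := eps_mul_self hε i
    calc ε i * ((1/2 : 𝕜) * (v (g i) + ε i * v i)) = (1/2 : 𝕜) * (ε i * v (g i) + (ε i * ε i) * v i) := by ring
      _ = (1/2 : 𝕜) * (v i + ε i * v (g i)) := by rw [eps_mul_self hε i, one_mul, add_comm]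
  have hanti : ∀ i, ε i * ((1/2 : 𝕜) • (v - w)) (g i) = - ((1/2 : 𝕜) • (v - w)) i := by
    intro i
    simp only [Pi.smul_apply, Pi.sub_apply, smul_eq_mul, hw, sgnAct, hg, hεg]
    calc ε i * ((1/2 : 𝕜) * (v (g i) - ε i * v i)) = (1/2 : 𝕜) * (ε i * v (g i) - (ε i * ε i) * v i) := by ring
      _ = -((1/2 : 𝕜) * (v i - ε i * v (g i))) := by rw [eps_mul_self hε i, one_mul]; ring
  have h1 := hP.dotProduct_mulVec_nonneg ((1/2 : 𝕜) • (v + w))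
  have h2 := hN.dotProduct_mulVec_nonneg ((1/2 : 𝕜) • (v - w))
  rw [form_foldPlus_of_fixed hg hεg hfix] at h1
  rw [form_foldMinus_of_antifixed hg hεg hanti] at h2
  exact add_nonneg (nonneg_of_two_mul_nonneg h1) (nonneg_of_two_mul_nonneg h2)

/-! ### §3 Reduction to orbit representatives -/

omit [Fintype ι] [DecidableEq ι] in
/-- Rows of `g i` of the `+` fold are `ε i` times the rows of `i`. [cite: HornJohnson2013, Observation 7.1.2] -/
theorem foldPlus_g_left (hg : ∀ i, g (g i) = i) (hε : ∀ i, ε i = 1 ∨ ε i = -1) (hεg : ∀ i, ε (g i) = ε i) (hsym : ∀ i j, M (g i)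
    (g j) = ε i * ε j * M i j) (i j : ι) : foldPlus M g ε (g i) j = ε i * foldPlus M g ε i j := by
  simp only [foldPlus]
  have h1 : M (g i) j = ε i * ε j * M i (g j) := by
    have h := hsym i (g j); rw [hg, hεg] at h; exact h
  rw [hsym i j, h1, show ε j * (ε i * ε j * M i j) = ε i * (ε j * ε j) * M i j by ring, eps_mul_self hε j]; ring

omit [Fintype ι] [DecidableEq ι] in
/-- Columns of `g j` of the `+` fold are `ε j` times the columns of `j`. [cite: HornJohnson2013, Observation 7.1.2] -/
theorem foldPlus_g_right (hg : ∀ i, g (g i) = i) (hε : ∀ i, ε i = 1 ∨ ε i = -1) (hεg : ∀ i, ε (g i) = ε i)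
    (i j : ι) : foldPlus M g ε i (g j) = ε j * foldPlus M g ε i j := by
  simp only [foldPlus, hg, hεg]
  rw [mul_add, ← mul_assoc, eps_mul_self hε j, one_mul, add_comm]

omit [Fintype ι] [DecidableEq ι] in
/-- Rows of `g i` of the `−` fold are `−ε i` times the rows of `i`. [cite: HornJohnson2013, Observation 7.1.2] -/
theorem foldMinus_g_left (hg : ∀ i, g (g i) = i) (hε : ∀ i, ε i = 1 ∨ ε i = -1) (hεg : ∀ i, ε (g i) = ε i) (hsym : ∀ i j, M (g i)
    (g j) = ε i * ε j * M i j) (i j : ι) : foldMinus M g ε (g i) j = -ε i * foldMinus M g ε i j := by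
  simp only [foldMinus]
  have h1 : M (g i) j = ε i * ε j * M i (g j) := by
    have h := hsym i (g j); rw [hg, hεg] at h; exact h
  rw [hsym i j, h1, show ε j * (ε i * ε j * M i j) = ε i * (ε j * ε j) * M i j by ring, eps_mul_self hε j]; ring

omit [Fintype ι] [DecidableEq ι] in
/-- Columns of `g j` of the `−` fold are `−ε j` times the columns of `j`. [cite: HornJohnson2013, Observation 7.1.2] -/
theorem foldMinus_g_right (hg : ∀ i, g (g i) = i) (hε : ∀ i, ε i = 1 ∨ ε i = -1) (hεg : ∀ i, ε (g i) = ε i)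
    (i j : ι) : foldMinus M g ε i (g j) = -ε j * foldMinus M g ε i j := by
  simp only [foldMinus, hg, hεg]
  have := eps_mul_self hε j
  calc M i (g j) - ε j * M i j = -ε j * M i j + (ε j * ε j) * M i (g j) := by rw [this]; ring
    _ = -ε j * (M i j - ε j * M i (g j)) := by ring

omit [DecidableEq ι] in
/-- **Retraction principle**: if `N i j = σ i σ j · N (ρ i) (ρ j)` for a map `ρ` into the representatives and real signs `σ`, then `N` is a congruence of a
pull-back of its representative submatrix, hence PSD when that submatrix is. [cite: HornJohnson2013, Observation 7.1.2] -/
theorem posSemidef_of_retraction {N : Matrix ι ι 𝕜} (p : ι → Prop) (ρ : ι → {i // p i}) (σ : ι → 𝕜) (hσ : ∀ i, star (σ i) = σ i)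
    (hN : ∀ i j, N i j = σ i * σ j * N (ρ i) (ρ j)) (hS : (Matrix.of fun r r' : {i // p i} => N r r').PosSemidef) : N.PosSemidef := by
  classical
  have h1 : (((Matrix.of fun r r' : {i // p i} => N r r').submatrix ρ ρ)).PosSemidef := hS.submatrix ρ
  have h2 := h1.mul_mul_conjTranspose_same (diagonal σ)
  have h3 : diagonal σ * ((Matrix.of fun r r' : {i // p i} => N r r').submatrix ρ ρ) * (diagonal σ)ᴴ = N := by
    ext i j
    rw [diagonal_conjTranspose, Matrix.mul_diagonal, Matrix.diagonal_mul, submatrix_apply, Matrix.of_apply, Pi.star_apply, hσ, hN i j]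
    ring
  rwa [h3] at h2

omit [DecidableEq ι] in
/-- **`+` fold: the representatives suffice.** For a decidable `p` with `p i ∨ p (g i)` for all `i`: if the `{i // p i}`-submatrix of `foldPlus M g ε`
is positive semidefinite, so is `foldPlus M g ε`. [cite: HornJohnson2013, Observation 7.1.2] -/
theorem posSemidef_foldPlus_of_reps (hg : ∀ i, g (g i) = i) (hε : ∀ i, ε i = 1 ∨ ε i = -1) (hεg : ∀ i, ε (g i) = ε i) (hsym : ∀ i j, M (g i)
    (g j) = ε i * ε j * M i j) (p : ι → Prop) [DecidablePred p] (hp : ∀ i, p i ∨ p (g i))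
    (hS : (Matrix.of fun r r' : {i // p i} => foldPlus M g ε r r').PosSemidef) : (foldPlus M g ε).PosSemidef := by
  let ρ : ι → {i // p i} := fun i => if h : p i then ⟨i, h⟩ else ⟨g i, (hp i).resolve_left h⟩
  let σ : ι → 𝕜 := fun i => if p i then 1 else ε i
  refine posSemidef_of_retraction p ρ σ (fun i => ?_) (fun i j => ?_) hS
  · by_cases h : p i <;> simp [σ, h, star_eps hε]
  · by_cases hi : p i <;> by_cases hj : p j <;> simp only [ρ, σ, hi, hj, dif_pos, dif_neg, if_true, if_false, not_false_eq_true, one_mul, mul_one]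
    · conv_lhs => rw [← hg j]
      rw [foldPlus_g_right hg hε hεg, hεg]
    · conv_lhs => rw [← hg i]
      rw [foldPlus_g_left hg hε hεg hsym, hεg]
    · conv_lhs => rw [← hg i, ← hg j]
      rw [foldPlus_g_left hg hε hεg hsym, foldPlus_g_right hg hε hεg, hεg, hεg, mul_assoc]

omit [DecidableEq ι] in
/-- **`−` fold: the representatives suffice.** [cite: HornJohnson2013, Observation 7.1.2] -/
theorem posSemidef_foldMinus_of_reps (hg : ∀ i, g (g i) = i) (hε : ∀ i, ε i = 1 ∨ ε i = -1) (hεg : ∀ i, ε (g i) = ε i) (hsym : ∀ i j, M (g i)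
    (g j) = ε i * ε j * M i j) (p : ι → Prop) [DecidablePred p] (hp : ∀ i, p i ∨ p (g i))
    (hS : (Matrix.of fun r r' : {i // p i} => foldMinus M g ε r r').PosSemidef) : (foldMinus M g ε).PosSemidef := by
  let ρ : ι → {i // p i} := fun i => if h : p i then ⟨i, h⟩ else ⟨g i, (hp i).resolve_left h⟩
  let σ : ι → 𝕜 := fun i => if p i then 1 else -ε i
  refine posSemidef_of_retraction p ρ σ (fun i => ?_) (fun i j => ?_) hS
  · by_cases h : p i <;> simp [σ, h, star_eps hε]
  · by_cases hi : p i <;> by_cases hj : p j <;> simp only [ρ, σ, hi, hj, dif_pos, dif_neg, if_true, if_false, not_false_eq_true, one_mul, mul_one]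
    · conv_lhs => rw [← hg j]
      rw [foldMinus_g_right hg hε hεg, hεg]
    · conv_lhs => rw [← hg i]
      rw [foldMinus_g_left hg hε hεg hsym, hεg]
    · conv_lhs => rw [← hg i, ← hg j]
      rw [foldMinus_g_left hg hε hεg hsym, foldMinus_g_right hg hε hεg, hεg, hεg, mul_assoc]

omit [DecidableEq ι] in
/-- **THE SIGNED-INVOLUTION BLOCK CRITERION ON REPRESENTATIVES**: with `p i ∨ p (g i)` for all `i`, positive semidefiniteness of the two
half-size tables `r r' ↦ M r r' + ε r' M r (g r')` and `r r' ↦ M r r' − ε r' M r (g r')` on `{i // p i}` gives `M ⪰ 0`.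
[cite: HornJohnson2013, Observation 7.1.2] [cite: LinGubernatis1993, §II] -/
theorem posSemidef_of_signedInvolution_reps (hM : M.IsHermitian) (hg : ∀ i, g (g i) = i) (hε : ∀ i, ε i = 1 ∨ ε i = -1)
    (hεg : ∀ i, ε (g i) = ε i) (hsym : ∀ i j, M (g i) (g j) = ε i * ε j * M i j) (p : ι → Prop) [DecidablePred p] (hp : ∀ i, p i ∨ p (g i))
    (hP : (Matrix.of fun r r' : {i // p i} => M r r' + ε r' * M r (g r')).PosSemidef)
    (hN : (Matrix.of fun r r' : {i // p i} => M r r' - ε r' * M r (g r')).PosSemidef) : M.PosSemidef :=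
  posSemidef_of_signedInvolution hM hg hε hεg hsym (posSemidef_foldPlus_of_reps hg hε hεg hsym p hp hP)
    (posSemidef_foldMinus_of_reps hg hε hεg hsym p hp hN)

end Symmetry

/-! ### §4 Device-ready INTEGER form -/

section IntCast

variable {ι : Type*} [Fintype ι]

/-- **INTEGER SIGNED-INVOLUTION BLOCKS.** `Z` an integer symmetric table, `g` an involution of the index type, `ε : ι → ℤ` with `ε i = ±1`,
`ε (g i) = ε i`, `Z (g i) (g j) = ε i ε j Z i j`, representatives `p` (`p i ∨ p (g i)`), and cast-positive-semidefiniteness of the two INTEGER tables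
`Z r r' ± ε r' · Z r (g r')` on `{i // p i}` ⇒ the cast of `Z` is positive semidefinite. All side conditions are decidable integer facts.
[cite: HornJohnson2013, Observation 7.1.2] [cite: LinGubernatis1993, §II] -/
theorem posSemidef_intCast_of_signedInvolution_reps {Z : Matrix ι ι ℤ} (hZ : Z.IsSymm) (g : ι → ι) (hg : ∀ i, g (g i) = i)
    (ε : ι → ℤ) (hε : ∀ i, ε i = 1 ∨ ε i = -1) (hεg : ∀ i, ε (g i) = ε i) (hsym : ∀ i j, Z (g i) (g j) = ε i * ε j * Z i j)
    (p : ι → Prop) [DecidablePred p] (hp : ∀ i, p i ∨ p (g i))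
    (hP : ((Matrix.of fun r r' : {i // p i} => Z r r' + ε r' * Z r (g r')).map (Int.cast : ℤ → 𝕜)).PosSemidef)
    (hN : ((Matrix.of fun r r' : {i // p i} => Z r r' - ε r' * Z r (g r')).map (Int.cast : ℤ → 𝕜)).PosSemidef) :
    (Z.map (Int.cast : ℤ → 𝕜)).PosSemidef := by
  have hM : (Z.map (Int.cast : ℤ → 𝕜)).IsHermitian := by
    refine Matrix.IsHermitian.ext fun i j => ?_
    rw [map_apply, map_apply, RCLike.star_def, map_intCast, ← hZ.apply i j]
  have hε' : ∀ i, ((ε i : ℤ) : 𝕜) = 1 ∨ ((ε i : ℤ) : 𝕜) = -1 := fun i => by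
    rcases hε i with h | h <;> simp [h]
  refine posSemidef_of_signedInvolution_reps hM hg (ε := fun i => ((ε i : ℤ) : 𝕜)) hε' (fun i => by rw [hεg])
    (fun i j => by rw [map_apply, map_apply, hsym]; push_cast; ring) p hp ?_ ?_
  · convert hP using 1
    ext r r'; simp [map_apply]
  · convert hN using 1
    ext r r'; simp [map_apply]

end IntCast

end Literature.Computation.Certificates

end
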